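import Literature.Analysis.Complex.StripPositivityRigidity
import Literature.Analysis.Complex.StripMollification
import HarnessLib

/-!
# Strip rigidity from non-negative WEAK boundary values on both lines

**Theorem (`strip_rigidity_of_nonneg_weak_boundary_values`).** Let `u` be holomorphic on the open strip
`S = {0 < im w < 1}` with `‖u(x + iy)‖ ≤ C y^{-p} (1 - y)^{-p} e^{a|x|}`, `p < 1`, `a < 2π`. Suppose that for
every smooth compactly supported `φ ≥ 0` whose support avoids a finite set `B₀ ⊂ ℝ` the pairings
`∫ u(x + iy) φ(x) dx` converge to a non-negative real as `y → 0⁺`, and likewise as `y → 1⁻` for `φ` supported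
off a finite set `B₁`. Then `u` is a non-negative constant on `S`.

This is, verbatim, the statement `StripRigidityWeak` (stub `stub_stripRigidity`) of the line
`iic-trace-flux-pairing` of crux `ParafermionToSLESixFamilies` (Cardy's formula for critical percolation on
`ℤ²`, sub-problem `CriticalPhenomena/CardyFormulaZ2`): there `u = (f/(Φ′)^{1/3}) ∘ Φ⁻¹` for a subsequential
scaling limit `f` of the spin-`1/3` parafermionic observable on a rectilinear polygon transported to the strip
by the strip map `Φ`, the weak boundary values are the (positive) touch measures of the exact flux pairing,
`B₀, B₁` are the images of the corners, the blow-up `(im w)^{-1/3}` comes from `d^{-1/3} |Φ′|^{-1/3}`, the type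
is `< 2π` at the two marked prime ends, and the conclusion identifies `f = c (Φ′)^{1/3}`, `c ≥ 0`.

Proof. (1) `weak_nonneg_of_finset` (`StripWeakBoundaryExceptional.lean`): the exceptional points are invisible,
on the bottom line for `u` and — via `weak_nonneg_reflect_top` — on the bottom line for the reflected function
`ũ(w) = conj (u (conj w + i))`, which is again holomorphic with the same growth
(`reflectTop_differentiableOn_and_growth`). (2) `stripMollify_eq_const`: for every smooth compactly
supported `φ ≥ 0` the mollification `u_φ(w) = ∫ u(w + t) φ(t) dt`, glued with its boundary values on both lines
(`stripMollify_boundary` of `StripMollification.lean` for `u` and for `ũ`, the two packages being exchanged by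
`w ↦ conj w + i`), is continuous on the closed strip, holomorphic inside, of exponential type `a` and
non-negative real on both lines, hence a non-negative constant by the continuous-boundary-value theorem
`strip_rigidity_of_nonneg_boundary_values` (`StripPositivityRigidity.lean`: double Schwarz reflection, Laurent
modes `e^{-πw}, 1, e^{πw}` for type `< 2π`, positivity on both lines kills `e^{∓πw}`). (3) `u_φ(w) → u(w)` as
`φ` shrinks to `δ₀` (`norm_stripMollify_bump_sub_le`), so `u` is constant, and the constant is a limit of
non-negative reals. Sharpness: `1 + e^{2πw}` (type `2π`) is positive on both lines.

References: the regularisation-in-`re` device is that of Streater–Wightman, *PCT, Spin and Statistics, and All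
That*, proof of Thm. 2-16; existence of the weak boundary values is Hörmander, *ALPDO I*, Thm. 3.1.15 (the
tree's `Literature.Analysis.Distribution.tendsto_integral_of_norm_le_inv_pow`). All statements folklore.
-/

noncomputable section

namespace Literature.Analysis.Complex

open _root_.Complex Set Filter Metric MeasureTheory
open scoped Topology Real ComplexConjugate

/-! ### The reflection `w ↦ conj (u (conj w + i))` exchanging the two boundary lines -/

/-- The reflected function `ũ(w) = conj (u (conj w + i))` is holomorphic on the strip and obeys the same growth
bound. [folklore] -/
theorem reflectTop_differentiableOn_and_growth {u : ℂ → ℂ} {C a p : ℝ}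
    (hd : DifferentiableOn ℂ u {w : ℂ | 0 < w.im ∧ w.im < 1})
    (hb : ∀ w : ℂ, 0 < w.im → w.im < 1 →
      ‖u w‖ ≤ C * w.im ^ (-p) * (1 - w.im) ^ (-p) * Real.exp (a * |w.re|)) :
    DifferentiableOn ℂ (fun w : ℂ => conj (u (conj w + I))) {w : ℂ | 0 < w.im ∧ w.im < 1} ∧
      ∀ w : ℂ, 0 < w.im → w.im < 1 → ‖conj (u (conj w + I))‖ ≤
        C * w.im ^ (-p) * (1 - w.im) ^ (-p) * Real.exp (a * |w.re|) := by
  constructor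
  · intro w hw
    apply DifferentiableAt.differentiableWithinAt
    have : (fun w : ℂ => conj (u (conj w + I))) = conj ∘ (fun v => u (v + I)) ∘ conj := by
      funext v; simp
    rw [this, differentiableAt_conj_conj_iff]
    refine (hd.differentiableAt ?_).comp _ (differentiableAt_id.add_const I)
    apply ((isOpen_Ioo (a := (0:ℝ)) (b := 1)).preimage continuous_im).mem_nhds
    simp only [mem_preimage, add_im, conj_im, I_im, mem_Ioo]
    exact ⟨by linarith [hw.2], by linarith [hw.1]⟩
  · intro w hw0 hw1
    rw [Complex.norm_conj]
    have := hb (conj w + I) (by simp; linarith) (by simp; linarith)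
    simp only [add_im, conj_im, I_im, add_re, conj_re, I_re, add_zero] at this
    calc ‖u (conj w + I)‖ ≤ C * (-w.im + 1) ^ (-p) * (1 - (-w.im + 1)) ^ (-p) * Real.exp (a * |w.re|) := this
      _ = C * w.im ^ (-p) * (1 - w.im) ^ (-p) * Real.exp (a * |w.re|) := by ring_nf

/-! ### Each mollification is a non-negative constant -/

/-- **The mollifications are constant.** Under the (reduced) growth bound and weak non-negativity of the
boundary values of `u` on the bottom line and of `ũ = conj ∘ u ∘ (conj + i)` on its bottom line (i.e. of `u`
on the top line), for all smooth compactly supported `φ ≥ 0` without exceptional points, every mollification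
`u_φ(w) = ∫ u(w + t) φ(t) dt` is a non-negative constant on the strip: `u_φ` glued with its boundary values is
continuous on the closed strip (`stripMollify_boundary` for `u` and `ũ`), of exponential type `a`, and
non-negative on both lines, so `strip_rigidity_of_nonneg_boundary_values` applies. [folklore] -/
theorem stripMollify_eq_const {u : ℂ → ℂ} {C a p : ℝ} (hC : 0 ≤ C) (ha0 : 0 ≤ a) (ha : a < 2 * π)
    (hp : 0 ≤ p) (hp1 : p < 1)
    (hd : DifferentiableOn ℂ u {w : ℂ | 0 < w.im ∧ w.im < 1})
    (hb : ∀ w : ℂ, 0 < w.im → w.im < 1 →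
      ‖u w‖ ≤ C * w.im ^ (-p) * (1 - w.im) ^ (-p) * Real.exp (a * |w.re|))
    (hP₀ : ∀ φ : ℝ → ℝ, ContDiff ℝ (⊤ : ℕ∞) φ → HasCompactSupport φ → (∀ x, 0 ≤ φ x) →
      ∃ L : ℝ, 0 ≤ L ∧ Tendsto (fun y : ℝ => ∫ x : ℝ, u (x + y * I) * (φ x : ℂ)) (𝓝[>] 0) (𝓝 (L : ℂ)))
    (hP₁ : ∀ φ : ℝ → ℝ, ContDiff ℝ (⊤ : ℕ∞) φ → HasCompactSupport φ → (∀ x, 0 ≤ φ x) →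
      ∃ L : ℝ, 0 ≤ L ∧ Tendsto (fun y : ℝ => ∫ x : ℝ,
        (conj (u (conj ((x : ℂ) + y * I) + I))) * (φ x : ℂ)) (𝓝[>] 0) (𝓝 (L : ℂ)))
    {φ : ℝ → ℝ} (hφ : ContDiff ℝ (⊤ : ℕ∞) φ) (hφc : HasCompactSupport φ) (hφ0 : ∀ x, 0 ≤ φ x) :
    ∃ c : ℝ, 0 ≤ c ∧ ∀ w : ℂ, 0 < w.im → w.im < 1 → (∫ t : ℝ, u (w + t) * (φ t : ℂ)) = c := by
  set S : Set ℂ := {w : ℂ | 0 < w.im ∧ w.im < 1} with hS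
  have hSo : IsOpen S := (isOpen_Ioo (a := (0:ℝ)) (b := 1)).preimage continuous_im
  set ut : ℂ → ℂ := fun w => conj (u (conj w + I)) with hut
  obtain ⟨hdt, hbt⟩ := reflectTop_differentiableOn_and_growth (C := C) (a := a) (p := p) hd hb
  -- boundary packages for `u` and `ũ`
  obtain ⟨g₀, hg₀, hc₀, K₀, hK₀⟩ := stripMollify_boundary hC ha0 hp hp1 hd hb hφ hφc
  obtain ⟨g₁, hg₁, hc₁, K₁, hK₁⟩ := stripMollify_boundary hC ha0 hp hp1 hdt hbt hφ hφc
  -- positivity of the boundary values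
  have htrans : ∀ x : ℝ, ContDiff ℝ (⊤ : ℕ∞) (fun s => φ (s - x)) ∧ HasCompactSupport (fun s => φ (s - x)) ∧
      ∀ s, 0 ≤ φ (s - x) := by
    intro x
    refine ⟨hφ.comp (contDiff_id.sub contDiff_const), ?_, fun s => hφ0 _⟩
    exact hφc.comp_homeomorph (Homeomorph.subRight x)
  have hg₀r : ∀ x : ℝ, ∃ r : ℝ, 0 ≤ r ∧ g₀ x = r := by
    intro x
    obtain ⟨L, hL0, hL⟩ := hP₀ (fun s => φ (s - x)) (htrans x).1 (htrans x).2.1 (htrans x).2.2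
    exact ⟨L, hL0, tendsto_nhds_unique (hg₀ x) hL⟩
  have hg₁r : ∀ x : ℝ, ∃ r : ℝ, 0 ≤ r ∧ g₁ x = r := by
    intro x
    obtain ⟨L, hL0, hL⟩ := hP₁ (fun s => φ (s - x)) (htrans x).1 (htrans x).2.1 (htrans x).2.2
    exact ⟨L, hL0, tendsto_nhds_unique (hg₁ x) hL⟩
  -- the glued function on the closed strip
  set uφ : ℂ → ℂ := fun w => ∫ t : ℝ, u (w + t) * (φ t : ℂ) with huφ
  set V₀ : ℂ → ℂ := fun w => if 0 < w.im then ∫ t : ℝ, u (w + t) * (φ t : ℂ) else g₀ w.re with hV₀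
  set V₁ : ℂ → ℂ := fun w => if 0 < w.im then ∫ t : ℝ, ut (w + t) * (φ t : ℂ) else g₁ w.re with hV₁
  set U : ℂ → ℂ := fun w => if w.im ≤ 0 then g₀ w.re else if 1 ≤ w.im then g₁ w.re else uφ w with hU
  -- the reflection identity for the mollifications
  have hrefl : ∀ w : ℂ, (∫ t : ℝ, ut (conj w + I + t) * (φ t : ℂ)) = conj (uφ w) := by
    intro w
    simp only [huφ, hut]
    rw [← integral_conj]
    congr 1; funext t
    have hpt : conj (conj w + I + (t : ℂ)) + I = w + t := by
      apply Complex.ext <;> simp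
    rw [map_mul, conj_ofReal, hpt]
  have hUS : ∀ w ∈ S, U w = uφ w := by
    intro w hw
    simp only [hU, if_neg (not_le.mpr hw.1), if_neg (not_le.mpr hw.2)]
  have hUV₀ : ∀ w : ℂ, 0 ≤ w.im → w.im < 1 → U w = V₀ w := by
    intro w hw0 hw1
    rcases hw0.eq_or_lt with h | h
    · simp only [hU, hV₀, ← h, le_refl, if_true, lt_irrefl, if_false]
    · rw [hUS w ⟨h, hw1⟩]; simp only [hV₀, if_pos h, huφ]
  have hUV₁ : ∀ w : ℂ, 0 < w.im → w.im ≤ 1 → U w = conj (V₁ (conj w + I)) := by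
    intro w hw0 hw1
    rcases hw1.lt_or_eq with h | h
    · rw [hUS w ⟨hw0, h⟩]
      have him : 0 < (conj w + I).im := by simp; linarith
      simp only [hV₁, if_pos him]
      rw [hrefl w, Complex.conj_conj]
    · have him : ¬ 0 < (conj w + I).im := by simp [h]
      obtain ⟨r, -, hr⟩ := hg₁r w.re
      simp only [hU, hV₁, if_neg him, if_neg (not_le.mpr hw0), h, le_refl, if_true, add_re, conj_re,
        I_re, add_zero, hr, conj_ofReal]
  -- (a) holomorphy
  have hdU : DifferentiableOn ℂ U S :=
    (differentiableOn_stripMollify hd hφ hφc).congr fun w hw => hUS w hw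
  -- (b) continuity on the closed strip
  have hσ : Continuous fun w : ℂ => conj w + I := by fun_prop
  have hcT₀ : ContinuousOn U {w : ℂ | 0 ≤ w.im ∧ w.im < 1} :=
    hc₀.congr fun w hw => hUV₀ w hw.1 hw.2
  have hcT₁ : ContinuousOn U {w : ℂ | 0 < w.im ∧ w.im ≤ 1} := by
    have : ContinuousOn (fun w => conj (V₁ (conj w + I))) {w : ℂ | 0 < w.im ∧ w.im ≤ 1} := by
      refine continuous_conj.comp_continuousOn (hc₁.comp hσ.continuousOn ?_)
      intro w hw
      simp only [mem_setOf_eq, add_im, conj_im, I_im]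
      exact ⟨by linarith [hw.2], by linarith [hw.1]⟩
    exact this.congr fun w hw => hUV₁ w hw.1 hw.2
  have hcU : ContinuousOn U {w : ℂ | 0 ≤ w.im ∧ w.im ≤ 1} := by
    intro w hw
    rcases hw.2.lt_or_eq with hlt | heq
    · have hmem : {v : ℂ | v.im < 1} ∈ 𝓝 w := (isOpen_lt continuous_im continuous_const).mem_nhds hlt
      rw [← continuousWithinAt_inter hmem]
      have hset : {w : ℂ | 0 ≤ w.im ∧ w.im ≤ 1} ∩ {v : ℂ | v.im < 1} = {w : ℂ | 0 ≤ w.im ∧ w.im < 1} := by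
        ext v; simp only [mem_inter_iff, mem_setOf_eq]
        constructor
        · rintro ⟨⟨h1, -⟩, h2⟩; exact ⟨h1, h2⟩
        · rintro ⟨h1, h2⟩; exact ⟨⟨h1, h2.le⟩, h2⟩
      rw [hset]
      exact hcT₀ w ⟨hw.1, hlt⟩
    · have hpos : 0 < w.im := by rw [heq]; exact one_pos
      have hmem : {v : ℂ | 0 < v.im} ∈ 𝓝 w := (isOpen_lt continuous_const continuous_im).mem_nhds hpos
      rw [← continuousWithinAt_inter hmem]
      have hset : {w : ℂ | 0 ≤ w.im ∧ w.im ≤ 1} ∩ {v : ℂ | 0 < v.im} = {w : ℂ | 0 < w.im ∧ w.im ≤ 1} := by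
        ext v; simp only [mem_inter_iff, mem_setOf_eq]
        constructor
        · rintro ⟨⟨-, h1⟩, h2⟩; exact ⟨h2, h1⟩
        · rintro ⟨h1, h2⟩; exact ⟨⟨h1.le, h2⟩, h1⟩
      rw [hset]
      exact hcT₁ w ⟨hpos, hw.2⟩
  -- (c) the bound
  have hbU : ∀ w : ℂ, 0 ≤ w.im → w.im ≤ 1 → ‖U w‖ ≤ max K₀ K₁ * Real.exp (a * |w.re|) := by
    intro w hw0 hw1
    rcases le_or_gt w.im (1 / 2) with h | h
    · rw [hUV₀ w hw0 (by linarith)]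
      exact (hK₀ w hw0 h).trans (mul_le_mul_of_nonneg_right (le_max_left _ _) (Real.exp_pos _).le)
    · rw [hUV₁ w (by linarith) hw1, Complex.norm_conj]
      have key : ‖V₁ (conj w + I)‖ ≤ K₁ * Real.exp (a * |(conj w + I).re|) :=
        hK₁ (conj w + I) (by simp; linarith) (by simp; linarith)
      have hre : (conj w + I).re = w.re := by simp
      rw [hre] at key
      exact le_trans key (mul_le_mul_of_nonneg_right (le_max_right K₀ K₁) (Real.exp_pos _).le)
  -- (d) boundary values
  have h0U : ∀ x : ℝ, ∃ r : ℝ, 0 ≤ r ∧ U x = r := by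
    intro x
    obtain ⟨r, hr, hgr⟩ := hg₀r x
    exact ⟨r, hr, by simp only [hU, ofReal_im, le_refl, if_true, ofReal_re, hgr]⟩
  have h1U : ∀ x : ℝ, ∃ r : ℝ, 0 ≤ r ∧ U (x + I) = r := by
    intro x
    obtain ⟨r, hr, hgr⟩ := hg₁r x
    refine ⟨r, hr, ?_⟩
    have h1 : ¬ ((x : ℂ) + I).im ≤ 0 := by simp
    have h2 : (1:ℝ) ≤ ((x : ℂ) + I).im := by simp
    simp only [hU, if_neg h1, if_pos h2, add_re, ofReal_re, I_re, add_zero, hgr]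
  -- Theorem C
  obtain ⟨c, hc0, hc⟩ :=
    strip_rigidity_of_nonneg_boundary_values U (max K₀ K₁) a ha hdU hcU hbU h0U h1U
  refine ⟨c, hc0, fun w hw0 hw1 => ?_⟩
  have := hc w hw0.le hw1.le
  rwa [hUS w ⟨hw0, hw1⟩] at this

/-! ### Approximation of `u` by its mollifications and the weak theorem -/

/-- `∫ u(w₀ + t) ρ(t) dt → u(w₀)` for normed bumps `ρ` of small radius (continuity of `u` at `w₀`). [folklore] -/
theorem norm_stripMollify_bump_sub_le {u : ℂ → ℂ}
    (hd : DifferentiableOn ℂ u {w : ℂ | 0 < w.im ∧ w.im < 1}) {w₀ : ℂ} (hw₀ : 0 < w₀.im ∧ w₀.im < 1)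
    {ε : ℝ} (hε : 0 < ε) :
    ∃ δ > 0, ∀ β : ContDiffBump (0:ℝ), β.rOut < δ →
      ‖(∫ t : ℝ, u (w₀ + t) * ((β.normed volume t : ℝ) : ℂ)) - u w₀‖ ≤ ε := by
  have hSo : IsOpen {w : ℂ | 0 < w.im ∧ w.im < 1} :=
    (isOpen_Ioo (a := (0:ℝ)) (b := 1)).preimage continuous_im
  have hcont : Continuous fun t : ℝ => u (w₀ + t) :=
    hd.continuousOn.comp_continuous (by fun_prop) fun t => by simpa using hw₀
  obtain ⟨δ, hδ, hδε⟩ := Metric.continuous_iff.mp hcont 0 ε hε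
  refine ⟨δ, hδ, fun β hβ => ?_⟩
  set ρ : ℝ → ℝ := β.normed volume with hρ
  have hρ1 : (∫ t : ℝ, ((ρ t : ℝ) : ℂ)) = 1 := by
    rw [integral_complex_ofReal, β.integral_normed]; simp
  have hρi : Integrable fun t : ℝ => ((ρ t : ℝ) : ℂ) := β.integrable_normed.ofReal
  have hint : Integrable fun t : ℝ => u (w₀ + t) * ((ρ t : ℝ) : ℂ) :=
    ((hcont.mul (continuous_ofReal.comp β.continuous_normed)).integrable_of_hasCompactSupport
      ((β.hasCompactSupport_normed (μ := volume)).comp_left (g := ofReal) rfl).mul_left)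
  have e : (∫ t : ℝ, u (w₀ + t) * ((ρ t : ℝ) : ℂ)) - u w₀ =
      ∫ t : ℝ, (u (w₀ + t) - u w₀) * ((ρ t : ℝ) : ℂ) := by
    simp_rw [sub_mul]
    rw [integral_sub hint (hρi.const_mul _), integral_const_mul, hρ1, mul_one]
  rw [e]
  have hpt : ∀ t : ℝ, ‖(u (w₀ + t) - u w₀) * ((ρ t : ℝ) : ℂ)‖ ≤ ε * ρ t := by
    intro t
    rw [norm_mul, Complex.norm_real, Real.norm_eq_abs, abs_of_nonneg (β.nonneg_normed t)]
    by_cases ht : ρ t = 0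
    · simp only [hρ] at ht; rw [ht]; simp only [mul_zero]
      exact mul_nonneg hε.le (β.nonneg_normed t)
    · have htsupp : t ∈ Function.support ρ := ht
      rw [hρ, β.support_normed_eq] at htsupp
      have htδ : dist t 0 < δ := lt_trans (mem_ball.mp htsupp) hβ
      have := hδε t htδ
      simp only [ofReal_zero, add_zero] at this
      exact mul_le_mul_of_nonneg_right (by rw [← dist_eq_norm]; exact this.le) (β.nonneg_normed t)
  calc ‖∫ t : ℝ, (u (w₀ + t) - u w₀) * ((ρ t : ℝ) : ℂ)‖ ≤ ∫ t : ℝ, ε * ρ t :=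
        norm_integral_le_of_norm_le (β.integrable_normed.const_mul ε) (Filter.Eventually.of_forall hpt)
    _ = ε := by rw [integral_const_mul, β.integral_normed, mul_one]

/-- **Strip rigidity from non-negative weak boundary values** (the form `StripRigidityWeak` of the line
`iic-trace-flux-pairing` of crux `ParafermionToSLESixFamilies`, Cardy's formula on `ℤ²`). Let `u` be holomorphic
on the open strip `S = {0 < im w < 1}` with `‖u(x + iy)‖ ≤ C y^{-p} (1-y)^{-p} e^{a|x|}`, `p < 1`, `a < 2π`, and
suppose that for every smooth compactly supported `φ ≥ 0` supported off a finite set `B₀` (resp. `B₁`) the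
pairings `∫ u(x + iy) φ(x) dx` converge to a non-negative real as `y → 0⁺` (resp. `y → 1⁻`). Then `u` is a
non-negative constant. Proof: the exceptional points are invisible (`weak_nonneg_of_finset`, the blow-up
`y^{-p}` being integrable); every mollification `u_φ = u ∗ₓ φ` is continuous up to both lines with non-negative
real boundary values and exponential type `a`, hence a non-negative constant (`stripMollify_eq_const`, i.e.
`strip_rigidity_of_nonneg_boundary_values` after Schwarz reflection and the Laurent-mode count in `e^{πw}`);
and `u_φ → u` pointwise as `φ → δ₀`. The example `1 + e^{2πw}` shows `a < 2π` is sharp. [folklore] -/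
theorem strip_rigidity_of_nonneg_weak_boundary_values :
    ∀ (u : ℂ → ℂ) (C a p : ℝ) (B₀ B₁ : Finset ℝ), a < 2 * Real.pi → p < 1 →
    DifferentiableOn ℂ u {w : ℂ | 0 < w.im ∧ w.im < 1} →
    (∀ w : ℂ, 0 < w.im → w.im < 1 →
      ‖u w‖ ≤ C * w.im ^ (-p) * (1 - w.im) ^ (-p) * Real.exp (a * |w.re|)) →
    (∀ φ : ℝ → ℝ, ContDiff ℝ (⊤ : ℕ∞) φ → HasCompactSupport φ → (∀ x, 0 ≤ φ x) →
      Disjoint (tsupport φ) (↑B₀ : Set ℝ) →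
      ∃ L : ℝ, 0 ≤ L ∧ Tendsto (fun y : ℝ => ∫ x : ℝ, u ((x : ℂ) + (y : ℂ) * Complex.I) * (φ x : ℂ))
        (𝓝[>] (0:ℝ)) (𝓝 (L : ℂ))) →
    (∀ φ : ℝ → ℝ, ContDiff ℝ (⊤ : ℕ∞) φ → HasCompactSupport φ → (∀ x, 0 ≤ φ x) →
      Disjoint (tsupport φ) (↑B₁ : Set ℝ) →
      ∃ L : ℝ, 0 ≤ L ∧ Tendsto (fun y : ℝ => ∫ x : ℝ, u ((x : ℂ) + (y : ℂ) * Complex.I) * (φ x : ℂ))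
        (𝓝[<] (1:ℝ)) (𝓝 (L : ℂ))) →
    ∃ c : ℝ, 0 ≤ c ∧ ∀ w : ℂ, 0 < w.im → w.im < 1 → u w = c := by
  intro u C a p B₀ B₁ ha hp hd hb h₀ h₁
  -- reduce to `C, a, p ≥ 0`
  set C' : ℝ := max C 0 with hC'
  set a' : ℝ := max a 0 with ha'
  set p' : ℝ := max p 0 with hp'
  have hC'0 : 0 ≤ C' := le_max_right _ _
  have ha'0 : 0 ≤ a' := le_max_right _ _
  have hp'0 : 0 ≤ p' := le_max_right _ _
  have ha'1 : a' < 2 * π := max_lt ha (by positivity)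
  have hp'1 : p' < 1 := max_lt hp one_pos
  have hb' : ∀ w : ℂ, 0 < w.im → w.im < 1 →
      ‖u w‖ ≤ C' * w.im ^ (-p') * (1 - w.im) ^ (-p') * Real.exp (a' * |w.re|) := by
    intro w hw0 hw1
    have hA : w.im ^ (-p) ≤ w.im ^ (-p') :=
      Real.rpow_le_rpow_of_exponent_ge hw0 hw1.le (neg_le_neg (le_max_left p 0))
    have hB : (1 - w.im) ^ (-p) ≤ (1 - w.im) ^ (-p') :=
      Real.rpow_le_rpow_of_exponent_ge (by linarith) (by linarith) (neg_le_neg (le_max_left p 0))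
    have hE : Real.exp (a * |w.re|) ≤ Real.exp (a' * |w.re|) :=
      Real.exp_le_exp.mpr (mul_le_mul_of_nonneg_right (le_max_left a 0) (abs_nonneg _))
    have hA0 : 0 ≤ w.im ^ (-p) := Real.rpow_nonneg hw0.le _
    have hB0 : 0 ≤ (1 - w.im) ^ (-p) := Real.rpow_nonneg (by linarith) _
    have hA0' : 0 ≤ w.im ^ (-p') := Real.rpow_nonneg hw0.le _
    have hB0' : 0 ≤ (1 - w.im) ^ (-p') := Real.rpow_nonneg (by linarith) _
    have hF : w.im ^ (-p) * (1 - w.im) ^ (-p) * Real.exp (a * |w.re|) ≤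
        w.im ^ (-p') * (1 - w.im) ^ (-p') * Real.exp (a' * |w.re|) :=
      mul_le_mul (mul_le_mul hA hB hB0 hA0') hE (Real.exp_pos _).le (mul_nonneg hA0' hB0')
    have hF0 : 0 ≤ w.im ^ (-p) * (1 - w.im) ^ (-p) * Real.exp (a * |w.re|) := by positivity
    calc ‖u w‖ ≤ C * w.im ^ (-p) * (1 - w.im) ^ (-p) * Real.exp (a * |w.re|) := hb w hw0 hw1
      _ = C * (w.im ^ (-p) * (1 - w.im) ^ (-p) * Real.exp (a * |w.re|)) := by ring
      _ ≤ C' * (w.im ^ (-p) * (1 - w.im) ^ (-p) * Real.exp (a * |w.re|)) :=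
          mul_le_mul_of_nonneg_right (le_max_left _ _) hF0
      _ ≤ C' * (w.im ^ (-p') * (1 - w.im) ^ (-p') * Real.exp (a' * |w.re|)) :=
          mul_le_mul_of_nonneg_left hF hC'0
      _ = C' * w.im ^ (-p') * (1 - w.im) ^ (-p') * Real.exp (a' * |w.re|) := by ring
  -- remove the exceptional points, on both lines
  have hP₀ := weak_nonneg_of_finset hC'0 ha'0 hp'0 hp'1 hd hb' B₀ h₀
  obtain ⟨hdt, hbt⟩ := reflectTop_differentiableOn_and_growth hd hb'
  have hP₁ := weak_nonneg_of_finset hC'0 ha'0 hp'0 hp'1 hdt hbt B₁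
    (weak_nonneg_reflect_top (u := u) (↑B₁ : Set ℝ) h₁)
  -- every mollification by a normed bump is a non-negative constant
  have hconst : ∀ β : ContDiffBump (0:ℝ), ∃ c : ℝ, 0 ≤ c ∧ ∀ w : ℂ, 0 < w.im → w.im < 1 →
      (∫ t : ℝ, u (w + t) * ((β.normed volume t : ℝ) : ℂ)) = c := fun β =>
    stripMollify_eq_const hC'0 ha'0 ha'1 hp'0 hp'1 hd hb' hP₀ hP₁ β.contDiff_normed
      β.hasCompactSupport_normed β.nonneg_normed
  -- approximate `u` at two points by the same mollification
  set w₀ : ℂ := ((1 / 2 : ℝ) : ℂ) * I with hw₀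
  have hw₀S : 0 < w₀.im ∧ w₀.im < 1 := by constructor <;> norm_num [hw₀]
  have key : ∀ w : ℂ, 0 < w.im ∧ w.im < 1 → ∀ ε > 0, ∃ c : ℝ, 0 ≤ c ∧ ‖u w - c‖ ≤ ε ∧ ‖u w₀ - c‖ ≤ ε := by
    intro w hw ε hε
    obtain ⟨δ₁, hδ₁, H1⟩ := norm_stripMollify_bump_sub_le hd hw hε
    obtain ⟨δ₂, hδ₂, H2⟩ := norm_stripMollify_bump_sub_le hd hw₀S hε
    let β : ContDiffBump (0:ℝ) := ⟨min δ₁ δ₂ / 4, min δ₁ δ₂ / 2, by positivity, by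
      have : 0 < min δ₁ δ₂ := by positivity
      linarith⟩
    have hβ1 : β.rOut < δ₁ := by
      show min δ₁ δ₂ / 2 < δ₁; linarith [min_le_left δ₁ δ₂, lt_min hδ₁ hδ₂]
    have hβ2 : β.rOut < δ₂ := by
      show min δ₁ δ₂ / 2 < δ₂; linarith [min_le_right δ₁ δ₂, lt_min hδ₁ hδ₂]
    obtain ⟨c, hc0, hc⟩ := hconst β
    refine ⟨c, hc0, ?_, ?_⟩
    · rw [← hc w hw.1 hw.2, norm_sub_rev]; exact H1 β hβ1
    · rw [← hc w₀ hw₀S.1 hw₀S.2, norm_sub_rev]; exact H2 β hβ2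
  obtain ⟨c₀, hc₀0, hc₀⟩ := exists_nonneg_ofReal_eq (ℓ := u w₀) fun ε hε => by
    obtain ⟨c, hc0, -, h2⟩ := key w₀ hw₀S (ε / 2) (by positivity)
    exact ⟨c, hc0, lt_of_le_of_lt h2 (by linarith)⟩
  refine ⟨c₀, hc₀0, fun w hw0 hw1 => ?_⟩
  have hsmall : ∀ ε > 0, ‖u w - u w₀‖ ≤ 2 * ε := by
    intro ε hε
    obtain ⟨c, -, h1, h2⟩ := key w ⟨hw0, hw1⟩ ε hε
    calc ‖u w - u w₀‖ = ‖(u w - c) - (u w₀ - c)‖ := by ring_nf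
      _ ≤ ‖u w - c‖ + ‖u w₀ - c‖ := norm_sub_le _ _
      _ ≤ 2 * ε := by linarith
  have heq : u w = u w₀ := by
    by_contra hne
    have hpos : 0 < ‖u w - u w₀‖ := norm_pos_iff.mpr (sub_ne_zero.mpr hne)
    have := hsmall (‖u w - u w₀‖ / 4) (by positivity)
    linarith
  rw [heq, hc₀]

end Literature.Analysis.Complex
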